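import Literature.AlgebraicGeometry.Resolution.AlterationsMultisectionProofs
import HarnessLib

/-!
# De Jong's alteration theorem: Lemma 4.13 reduced to its local step (one hyperplane section)

Topic: `Literature/AlgebraicGeometry/Resolution`. Second layer under `AlterationsMultisection.lean`
(de Jong 1996, Lemma 4.13 = `DeJong1996MultisectionLemma`, 4.14 =
`DeJong1996MultisectionReduction`, the latter proved from the former in
`AlterationsMultisectionProofs.lean`). The printed proof of Lemma 4.13 (pp. 69–70) produces,
for ONE closed point `y ∈ Y`, a hyperplane section `H = X ∩ H'` with (i) and with (ii) over a
neighbourhood of `y`, and then globalises: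

> "Take `H' ∈ U` and put `H = X ∩ H'`. The morphism `f|_H : H → Y` is quasi-finite hence finite
> (as `H' ∉ pr₁(T)`). […] Therefore `f|_H : H → Y` is finite étale over a neighbourhood of `y`
> in `Y`. […] Any component of `H` dominates `Y` in view of dimensions, hence `f|_H` is
> generically étale. We claim that there exists an open neighbourhood `U ⊂ Y` of `y` such that
> (ii) holds for geometric points of `U`. […] The degree of `C` in `𝐏` is at least `n`, hence if
> `n ≥ 3` we get our claim. If `U ≠ Y`, take a closed point `y' ∈ Y ∖ U` and choose `H' ⊂ X`,
> which has property (i) and satisfies (ii) over an open neighbourhood `U'` of `y'`. Then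
> `H ∪ H' ⊂ X` satisfies (i) and (ii) over `U ∪ U'`. Continuing like this we get the result by
> Noetherian induction." (p. 70)

Accordingly this file

* defines **(ii) over an open `U ⊆ Y`**, `DeJong1996.HasThreeSmoothPointsOver f Z U` (the
  condition of `DeJong1996.HasThreeSmoothPoints` for the geometric points `ȳ : Spec K → Y`
  landing in `U`); proved API: monotonicity in `Z` and `U`, `U = Y` is
  `HasThreeSmoothPoints` (`univ_iff`), and the local-to-global principle
  `hasThreeSmoothPoints_of_iUnion` (a geometric point lands in one member of an open cover);
* vendors the local step as a NAMED FACT `DeJong1996MultisectionLocal` — for `f : X → Y` as in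
  Lemma 4.13 and a closed point `y ∈ Y` there is a divisor `H ⊂ X` with (i) `f|_H` finite and
  generically étale and (ii) over an open neighbourhood of `y` (the very ample embedding, the
  incidence variety `T` and its dimension count 2.7, the Bertini-type choice of `H'`, the local
  analysis "finite étale over a neighbourhood of `y`" and the degree count are its inputs);
* PROVES the globalisation `DeJong1996MultisectionLemma.of_local` ("Then `H ∪ H' ⊂ X` satisfies
  (i) and (ii) over `U ∪ U'`. Continuing like this we get the result by Noetherian induction"):
  `Y` is quasi-compact, every point specialises to a closed point
  (`IsClosed.exists_closed_singleton`), so finitely many neighbourhoods `U_{y_j}` cover `Y`;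
  the finite union `⋃ H_{y_j}` is the support of the product divisor
  (`exists_isEffectiveCartier_biUnion`), `f` is finite and generically étale on it
  (`DeJong1996.IsFiniteGenericallyEtaleOn.biUnion`, from the two-set case of
  `AlterationsMultisectionProofs.lean`), and (ii) holds globally by the local-to-global principle;
* rewires: `DeJong1996MultisectionReduction.of_multisectionLocal`,
  `DeJong1996FibrationToSemiStablePair.of_multisectionLocal_of_toSemiStablePair`,
  `DeJong1996StrongAlgClosed.of_fibration_multisectionLocal_toSemiStablePair_resolution`.

## Sources

* A. J. de Jong, *Smoothness, semi-stability and alterations*, Publ. Math. IHÉS 83 (1996) 51–93: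
  Lemma 4.13 and its proof (pp. 69–70), 4.14 (p. 70). [DeJong1996]
-/

noncomputable section

open CategoryTheory CategoryTheory.Limits AlgebraicGeometry TopologicalSpace Topology

namespace Literature.AlgebraicGeometry.Resolution

universe u

namespace DeJong1996

/-! ## (ii) over an open of the base -/

/-- **de Jong 1996, Lemma 4.13 (ii) over `U ⊆ Y`** ("(ii) holds for geometric points of `U`",
p. 70): for every algebraically closed field `K` and every `ȳ : Spec K → Y` landing in `U`,
every irreducible component `C` of the geometric fibre `X_ȳ = X ×_Y Spec K` contains at least
`3` points whose image in `X` lies in `sm(X/Y) ∩ Z` — the condition of `HasThreeSmoothPoints`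
restricted to the geometric points of `U`. [cite: DeJong1996, Lemma 4.13 (proof), p. 70] -/
def HasThreeSmoothPointsOver {X Y : Scheme.{u}} (f : X ⟶ Y) [LocallyOfFinitePresentation f]
    (Z : Set X) (U : Set Y) : Prop :=
  ∀ (K : Type u) [Field K] [IsAlgClosed K] (y : Spec (.of K) ⟶ Y), Set.range y ⊆ U →
    ∀ C ∈ irreducibleComponents ↥(pullback f y),
      3 ≤ (C ∩ (pullback.fst f y) ⁻¹' ((f.smoothLocus : Set X) ∩ Z)).encard

namespace HasThreeSmoothPointsOver

variable {X Y : Scheme.{u}} {f : X ⟶ Y} [LocallyOfFinitePresentation f] {Z Z' : Set X}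
  {U U' : Set Y}

/-- (ii) over `U` is monotone in `Z` and antitone in `U`. [folklore] -/
theorem mono (hZ : Z ⊆ Z') (hU : U' ⊆ U) (h : HasThreeSmoothPointsOver f Z U) :
    HasThreeSmoothPointsOver f Z' U' :=
  fun K _ _ y hy C hC => (h K y (hy.trans hU) C hC).trans (Set.encard_le_encard
    (Set.inter_subset_inter_right _ (Set.preimage_mono (Set.inter_subset_inter_right _ hZ))))

/-- (ii) (for all geometric points) gives (ii) over any `U`. [folklore] -/
theorem of_hasThreeSmoothPoints (h : HasThreeSmoothPoints f Z) (U : Set Y) :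
    HasThreeSmoothPointsOver f Z U :=
  fun K _ _ y _ C hC => h K y C hC

/-- (ii) over `U = Y` is (ii). [folklore] -/
theorem hasThreeSmoothPoints (h : HasThreeSmoothPointsOver f Z Set.univ) :
    HasThreeSmoothPoints f Z :=
  fun K _ _ y C hC => h K y (Set.subset_univ _) C hC

/-- (ii) over `U = Y` is (ii). [folklore] -/
theorem univ_iff : HasThreeSmoothPointsOver f Z Set.univ ↔ HasThreeSmoothPoints f Z :=
  ⟨hasThreeSmoothPoints, fun h => of_hasThreeSmoothPoints h _⟩

/-- **Local-to-global for (ii)** ("`H ∪ H'` satisfies (ii) over `U ∪ U'`", iterated): if the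
`U i` cover `Y` and (ii) holds for `Z i ⊆ Z` over `U i` for every `i`, then (ii) holds for `Z`
— a geometric point `ȳ : Spec K → Y` has a one-point source, so lands in some `U i`.
[cite: DeJong1996, Lemma 4.13 (proof), p. 70] -/
theorem hasThreeSmoothPoints_of_iUnion {ι : Type*} {Us : ι → Set Y}
    (hU : ⋃ i, Us i = Set.univ) {Zs : ι → Set X} (hZ : ∀ i, Zs i ⊆ Z)
    (h : ∀ i, HasThreeSmoothPointsOver f (Zs i) (Us i)) : HasThreeSmoothPoints f Z := by
  intro K _ _ y C hC
  have hx : y (default : PrimeSpectrum K) ∈ ⋃ i, Us i := by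
    rw [hU]
    trivial
  obtain ⟨i, hi⟩ := Set.mem_iUnion.mp hx
  have hrange : Set.range y ⊆ Us i := by
    rintro _ ⟨p, rfl⟩
    rwa [Subsingleton.elim p (default : PrimeSpectrum K)]
  exact (h i).mono (hZ i) le_rfl K y hrange C hC

end HasThreeSmoothPointsOver

/-! ## Finite unions -/

/-- Finite unions of supports of effective Cartier divisors are supports of effective Cartier
divisors (the product of the ideal sheaves; the empty union is the support of the unit ideal).
[folklore] -/
theorem _root_.Literature.AlgebraicGeometry.Resolution.exists_isEffectiveCartier_biUnion
    {X : Scheme.{u}} {ι : Type*} (t : Finset ι) (H : ι → Set X)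
    (h : ∀ i ∈ t, ∃ I : X.IdealSheafData, IsEffectiveCartier I ∧ (I.support : Set X) = H i) :
    ∃ I : X.IdealSheafData, IsEffectiveCartier I ∧ (I.support : Set X) = ⋃ i ∈ t, H i := by
  classical
  induction t using Finset.induction_on with
  | empty =>
    exact ⟨⊤, isEffectiveCartier_top, by simp [Scheme.IdealSheafData.support_top]⟩
  | @insert a s ha ih =>
    rw [Finset.set_biUnion_insert]
    exact exists_isEffectiveCartier_union (h a (Finset.mem_insert_self a s))
      (ih fun i hi => h i (Finset.mem_insert_of_mem hi))

/-- `f` proper and finite, generically étale on each of finitely many (`≥ 1`) subsets is finite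
and generically étale on their union (`IsFiniteGenericallyEtaleOn.union`, iterated).
[cite: DeJong1996, Lemma 4.13 (proof), p. 70] -/
theorem IsFiniteGenericallyEtaleOn.biUnion {X Y : Scheme.{u}} {f : X ⟶ Y} [IsProper f]
    {ι : Type*} (t : Finset ι) (ht : t.Nonempty) (H : ι → Set X)
    (h : ∀ i ∈ t, IsFiniteGenericallyEtaleOn f (H i)) :
    IsFiniteGenericallyEtaleOn f (⋃ i ∈ t, H i) := by
  classical
  induction t using Finset.induction_on with
  | empty => exact absurd ht Finset.not_nonempty_empty
  | @insert a s ha ih =>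
    rw [Finset.set_biUnion_insert]
    rcases s.eq_empty_or_nonempty with rfl | hs
    · simpa using h a (Finset.mem_insert_self a _)
    · exact (h a (Finset.mem_insert_self a s)).union
        (ih hs fun i hi => h i (Finset.mem_insert_of_mem hi))

end DeJong1996

/-! ## The local step of Lemma 4.13 as a named fact -/

/-- NAMED FACT — **de Jong 1996, proof of Lemma 4.13, the local step at a closed point.** For
`f : X → Y` a morphism of projective varieties over an algebraically closed field `k` with
(vi) a), b) (the hypotheses of Lemma 4.13, rendered exactly as in `DeJong1996MultisectionLemma`)
and a closed point `y ∈ Y(k)`: "Let `ℒ` be a very ample line bundle on `X` and let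
`i : X → 𝐏 = 𝐏(Γ(X, ℒ^{⊗n}))` be the projective embedding associated to `ℒ^{⊗n}` [`n ≥ 3`
large] […] `T = {(H, y) ∈ 𝐏^∨ × Y | dim f⁻¹(y) ∩ H = 1}` […] `dim T ≤ dim Y + dim 𝐏^∨ - n`
[2.7] […] `pr₁(T) ≠ 𝐏^∨`. Let `y ∈ Y(k)` be a closed point. Consider
`U = {H ∈ 𝐏^∨ | H ∉ pr₁(T), H ∩ f⁻¹(y) ⊂ sm(X/Y), H ∩ f⁻¹(y) is a reduced scheme}` […]
`U ⊂ 𝐏^∨` is nonempty open. Take `H' ∈ U` and put `H = X ∩ H'`. The morphism `f|_H : H → Y`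
is quasi-finite hence finite (as `H' ∉ pr₁(T)`). […] Therefore `f|_H : H → Y` is finite étale
over a neighbourhood of `y` in `Y`. […] Any component of `H` dominates `Y` in view of
dimensions, hence `f|_H` is generically étale. We claim that there exists an open neighbourhood
`U ⊂ Y` of `y` such that (ii) holds for geometric points of `U`. […] The degree of `C` in `𝐏`
is at least `n`, hence if `n ≥ 3` we get our claim." Rendered: there is `H ⊆ X`, the support of
an effective Cartier divisor (the hyperplane section `X ∩ H'` of the integral `X`, 2.3), with
(i) `DeJong1996.IsFiniteGenericallyEtaleOn f H` (reduced structure, 2.2) and (ii) over some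
open `U ∋ y` (`DeJong1996.HasThreeSmoothPointsOver f H U`). Lemma 4.13 itself follows by the
proved globalisation `DeJong1996MultisectionLemma.of_local`. Users take
`(h : DeJong1996MultisectionLocal)`. [cite: DeJong1996, Lemma 4.13 (proof), pp. 69–70] -/
def DeJong1996MultisectionLocal : Prop :=
  ∀ (k : Type u) [Field k] [IsAlgClosed k] (X Y : Scheme.{u}) [IsIntegral X] [IsIntegral Y]
    (f : X ⟶ Y) [LocallyOfFinitePresentation f] (g : Y ⟶ Spec (.of k)),
    Literature.AlgebraicGeometry.Motives.IsProjectiveOver (Over.mk (f ≫ g)) →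
      Literature.AlgebraicGeometry.Motives.IsProjectiveOver (Over.mk g) →
        Surjective f → GeometricallyConnected f →
          (∀ (y : Y), ∀ C ∈ irreducibleComponents ↥(f.fiber y), topologicalKrullDim ↥C = 1) →
            (∀ y : Y, Dense ((f.fiberι y) ⁻¹' (f.smoothLocus : Set X))) →
              ∀ y : Y, IsClosed ({y} : Set Y) →
                ∃ H : Set X,
                  (∃ I : X.IdealSheafData, IsEffectiveCartier I ∧ (I.support : Set X) = H) ∧
                    DeJong1996.IsFiniteGenericallyEtaleOn f H ∧
                      ∃ U : Y.Opens, y ∈ U ∧ DeJong1996.HasThreeSmoothPointsOver f H U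

/-- Sanity of the cut: the global Lemma 4.13 gives its local step (take the global `H` and
`U = Y`). [folklore] -/
theorem DeJong1996MultisectionLocal.of_multisectionLemma (h13 : DeJong1996MultisectionLemma.{u}) :
    DeJong1996MultisectionLocal.{u} := by
  intro k _ _ X Y _ _ f _ g hX hY hsurj hgc hdim hdense y _
  obtain ⟨H, hHdiv, hHfin, hH3⟩ := h13 k X Y f g hX hY hsurj hgc hdim hdense
  exact ⟨H, hHdiv, hHfin, ⊤, trivial, DeJong1996.HasThreeSmoothPointsOver.of_hasThreeSmoothPoints
    hH3 _⟩

/-- **de Jong 1996, Lemma 4.13 from its local step** ("If `U ≠ Y`, take a closed point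
`y' ∈ Y ∖ U` and choose `H' ⊂ X`, which has property (i) and satisfies (ii) over an open
neighbourhood `U'` of `y'`. Then `H ∪ H' ⊂ X` satisfies (i) and (ii) over `U ∪ U'`. Continuing
like this we get the result by Noetherian induction."): `Y` being quasi-compact (projective over
`k`) and every point of `Y` specialising to a closed point, finitely many of the neighbourhoods
`U_y` (`y` closed) cover `Y`; the union of the corresponding divisors is a divisor
(`exists_isEffectiveCartier_biUnion`), `f` is finite and generically étale on it
(`DeJong1996.IsFiniteGenericallyEtaleOn.biUnion`, `f` being proper), and (ii) holds for it at
every geometric point (`DeJong1996.HasThreeSmoothPointsOver.hasThreeSmoothPoints_of_iUnion`).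
[cite: DeJong1996, Lemma 4.13 (proof), p. 70] -/
theorem DeJong1996MultisectionLemma.of_local (hloc : DeJong1996MultisectionLocal.{u}) :
    DeJong1996MultisectionLemma.{u} := by
  intro k _ _ X Y _ _ f _ g hX hY hsurj hgc hdim hdense
  haveI : IsProper (f ≫ g) :=
    Literature.AlgebraicGeometry.Motives.IsProjectiveOver.isProper (X := Over.mk (f ≫ g)) hX
  haveI : IsProper g :=
    Literature.AlgebraicGeometry.Motives.IsProjectiveOver.isProper (X := Over.mk g) hY
  haveI : IsProper f := IsProper.of_comp f g
  haveI : CompactSpace Y := QuasiCompact.compactSpace_of_compactSpace g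
  -- a divisor and a neighbourhood for every closed point
  have key := hloc k X Y f g hX hY hsurj hgc hdim hdense
  choose H hHdiv hHfin U hyU hHU using fun y : {y : Y // IsClosed ({y} : Set Y)} => key y.1 y.2
  -- the neighbourhoods cover `Y`: every point specialises to a closed point
  have hcover : (Set.univ : Set Y) ⊆ ⋃ y, (U y : Set Y) := by
    intro x _
    obtain ⟨y₀, hy₀, hy₀c⟩ := (isClosed_closure (s := ({x} : Set Y))).exists_closed_singleton
      ⟨x, subset_closure rfl⟩
    have hspec : x ⤳ y₀ := specializes_iff_mem_closure.mpr hy₀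
    exact Set.mem_iUnion.mpr ⟨⟨y₀, hy₀c⟩, hspec.mem_open (U _).isOpen (hyU _)⟩
  obtain ⟨t, ht⟩ := isCompact_univ.elim_finite_subcover (fun y => (U y : Set Y))
    (fun y => (U y).isOpen) hcover
  have htne : t.Nonempty := by
    obtain ⟨x⟩ := (inferInstance : Nonempty Y)
    obtain ⟨i, hi, -⟩ := Set.mem_iUnion₂.mp (ht (Set.mem_univ x))
    exact ⟨i, hi⟩
  refine ⟨⋃ y ∈ t, H y, exists_isEffectiveCartier_biUnion t _ (fun y _ => hHdiv y),
    DeJong1996.IsFiniteGenericallyEtaleOn.biUnion t htne _ (fun y _ => hHfin y), ?_⟩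
  refine DeJong1996.HasThreeSmoothPointsOver.hasThreeSmoothPoints_of_iUnion (ι := {y // y ∈ t})
    (Us := fun y => (U y.1 : Set Y)) ?_ (Zs := fun y => H y.1) (fun y => ?_) (fun y => hHU y.1)
  · apply Set.eq_univ_of_univ_subset
    intro x hx
    obtain ⟨i, hi, hx'⟩ := Set.mem_iUnion₂.mp (ht hx)
    exact Set.mem_iUnion.mpr ⟨⟨i, hi⟩, hx'⟩
  · exact Finset.subset_set_biUnion_of_mem (f := fun y => H y) y.2

/-! ## Rewiring on the local step -/

/-- 4.14 (`DeJong1996MultisectionReduction`) from the local step of Lemma 4.13.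
[cite: DeJong1996, 4.13–4.14, pp. 69–70] -/
theorem DeJong1996MultisectionReduction.of_multisectionLocal
    (hloc : DeJong1996MultisectionLocal.{u}) : DeJong1996MultisectionReduction.{u} :=
  DeJong1996MultisectionReduction.of_multisectionLemma (DeJong1996MultisectionLemma.of_local hloc)

/-- 4.13–4.22 (`DeJong1996FibrationToSemiStablePair`) from the local step of Lemma 4.13 and
4.15–4.22. [cite: DeJong1996, 4.13–4.22, pp. 69–75] -/
theorem DeJong1996FibrationToSemiStablePair.of_multisectionLocal_of_toSemiStablePair
    (hloc : DeJong1996MultisectionLocal.{u}) (h15 : DeJong1996MultisectionToSemiStablePair.{u}) :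
    DeJong1996FibrationToSemiStablePair.{u} :=
  DeJong1996FibrationToSemiStablePair.of_multisectionLemma_of_toSemiStablePair
    (DeJong1996MultisectionLemma.of_local hloc) h15

/-- Thm. 4.1 with its generically-étale clause over algebraically closed fields
(`DeJong1996StrongAlgClosed`) from 4.11–4.12, the local step of Lemma 4.13, 4.15–4.22 and
4.23–4.28. [cite: DeJong1996, 4.3–4.28, pp. 66–76] -/
theorem DeJong1996StrongAlgClosed.of_fibration_multisectionLocal_toSemiStablePair_resolution
    (h₁ : DeJong1996FibrationReduction.{u}) (hloc : DeJong1996MultisectionLocal.{u})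
    (h15 : DeJong1996MultisectionToSemiStablePair.{u}) (hres : DeJong1996SemiStablePairResolution.{u}) :
    DeJong1996StrongAlgClosed.{u} :=
  DeJong1996StrongAlgClosed.of_fibration_multisectionLemma_toSemiStablePair_resolution h₁
    (DeJong1996MultisectionLemma.of_local hloc) h15 hres

/-- Thm. 4.1 (i)+(ii) over every field from 4.5 (`DeJong1996Descent`), 4.11–4.12, the local
step of Lemma 4.13, 4.15–4.22 and 4.23–4.28. [cite: DeJong1996, 4.3–4.28, pp. 66–76] -/
theorem DeJong1996Strong.of_descent_fibration_multisectionLocal_toSemiStablePair_resolution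
    (h45 : DeJong1996Descent.{u}) (h₁ : DeJong1996FibrationReduction.{u})
    (hloc : DeJong1996MultisectionLocal.{u}) (h15 : DeJong1996MultisectionToSemiStablePair.{u})
    (hres : DeJong1996SemiStablePairResolution.{u}) : DeJong1996Strong.{u} :=
  DeJong1996Strong.of_descent_fibration_multisectionLemma_toSemiStablePair_resolution h45 h₁
    (DeJong1996MultisectionLemma.of_local hloc) h15 hres

end Literature.AlgebraicGeometry.Resolution

end
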